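import Summits.BirchSwinnertonDyer.BirchSwinnertonDyer.Theorems.SignedLowerHalvesKobayashiLowerHalfSemistableDefmuMuParity
import HarnessLib

/-!
# The anticyclotomic theta elements `θ_n^{ac}` are compatible along the layer maps `Pic(𝒪_{p^{n+2}})/Δ → Pic(𝒪_{p^{n+1}})/Δ`,
# and Vatsal's / Pollack–Weston's "`μ(θ^{ac}) = 0`" (`HasMuZeroAc`) for one tower is ONE unit coefficient at ONE layer

Route-independent `Theorems` file (cell `b2b-bsdres`, seat `b2b-bsdres-x10b`, gen 43; sequel of the `torsionImage` files of the series
«defmu / supersingular theta elements», written for the ORDINARY carrier `GrossPointTower.thetaAc` of route DefiniteTheta's crux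
`DerivedHeightCap` (stmt-BirchSwinnertonDyer-18438: its stubs `stub_normCompatible` — landed p747225 — and `stub_towerSqrt` work "along a
norm-compatible family in `ℤ_p[G_n^{ac}]`").
HONEST FRAMING: no curve asserted, no rank statement or class closed, BSD not proved.

* `torsionImage_le_comap_picRes` — the restriction maps `Δ`-images into `Δ`-images (part 2a), packaged as the hypothesis of
  `QuotientGroup.map`: the layer map `π_n^{ac} : G_{n+2}^{ac} → G_{n+1}^{ac}` is well defined (every `p`, every number field `K`).
* `coeff_thetaAc_eq_sum` — **`π^{ac}_*(θ^{ac}_{n+1}) = θ^{ac}_n` coefficientwise** for a norm-compatible tower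
  (`GrossPointTower.IsNormCompatible`, BD96 Prop. 2.7): `θ^{ac}_n(q) = Σ_{τ ∈ G̃_{n+2}, [τ̄] = q} θ_{n+1}(τ)`.
* `dvd_coeff_thetaAc_of_succ`, `exists_isUnit_coeff_thetaAc_add` — divisibility of all coefficients DESCENDS the tower, a unit coefficient
  ASCENDS; hence **`hasMuZeroAc_iff_exists`**: `T.HasMuZeroAc p φ α ↔ ∃ n q, IsUnit ((θ^{ac}_n).coeff q)` — the finite-level form of
  Vatsal's `μ(L_p(f,K)) = 0` (named fact `vatsal_hasMuZeroAc` = PW Thm. 2.3 (1)) holds for a given tower as soon as ONE coefficient at ONE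
  layer is a unit; `hasMuZeroAc_iff_exists_of_ordinary` in the hypothesis currency of `grossPointTower_isNormCompatible` (unit root `α`).

## References

* [BertoliniDarmon1996] Prop. 2.7, §2.7; [BertoliniDarmon2005] §1.2 (18)–(21) (`θ^{ac}`, `Λ = ℤ_p⟦G̃_∞/Δ⟧`).
* [PollackWeston2011] §2.3, Thm. 2.3 (1) (Vatsal: `μ(L_p(f, K)) = 0`); [Vatsal2003] Thm. 1.1.
-/

noncomputable section

open scoped BigOperators Matrix

-- D-0017: single-problem summit, the namespace repeats the problem name by design.
set_option linter.dupNamespace false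

namespace Summit.BirchSwinnertonDyer.BirchSwinnertonDyer.Theorems.AcLayerTheta

open Literature.NumberTheory.EllipticCurves Literature.NumberTheory.EllipticCurves.QuadOrderTower
  Literature.NumberTheory.Automorphic NumberField
open Summit.BirchSwinnertonDyer.BirchSwinnertonDyer.Theorems.DefmuSupersingularTheta
  (picRes_mem_torsionImage coeff_mapDomainRingHom_eq_sum isUnit_iff_not_dvd)

universe u

variable {K : Type u} [Field K] [NumberField K] (p : ℕ) [hp : Fact p.Prime]
  {Nplus Nminus : ℕ} {S : Brandt.XiSetup Nplus Nminus}

/-! ### §1 The layer maps `G_{n+2}^{ac} → G_{n+1}^{ac}` -/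

/-- `torsionImage (n+2)` restricts into `torsionImage (n+1)`, as the well-definedness hypothesis of `QuotientGroup.map` for the
layer map `Pic(𝒪_{p^{n+2}})/Δ → Pic(𝒪_{p^{n+1}})/Δ`. [cite: BertoliniDarmon2005, §1.2 (21)] -/
theorem torsionImage_le_comap_picRes (n : ℕ) :
    torsionImage K p (n + 1 + 1) ≤ (torsionImage K p (n + 1)).comap (picRes K (pow_dvd_pow p (n + 1).le_succ)) := by
  intro g hg
  rw [Subgroup.mem_comap]
  exact picRes_mem_torsionImage p (n + 1).le_succ hg

/-! ### §2 The coefficients of `θ^{ac}_n` are fibre sums of those of `θ_{n+1}` -/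

variable (φ : Brandt.ClassSet S.O → ℤ) (α : ℤ_[p]ˣ) (T : GrossPointTower K S p)

open Summit.BirchSwinnertonDyer.BirchSwinnertonDyer.Theorems.DefmuSupersingularTheta
  (coeff_groupRingProj dvd_sum_filter_comp_coeff acProj_picRes_eq_of_acProj_eq)

/-- **`θ^{ac}_n(q) = Σ_{τ ∈ G̃_{n+2}, [τ̄] = q} θ_{n+1}(τ)`** for a norm-compatible tower (`θ_{n+1} ↦ θ_n` in `ℤ_p[G̃]`, BD96 Prop. 2.7):
the `q`-coefficient of the anticyclotomic image `θ^{ac}_n` is the sum of the coefficients of `θ_{n+1} ∈ ℤ_p[G̃_{n+2}]` over the classes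
`τ` whose restriction lies in the `Δ`-coset `q` — i.e. `π^{ac}_*(θ^{ac}_{n+1}) = θ^{ac}_n` read coefficientwise.
[cite: BertoliniDarmon1996, Prop. 2.7 and §2.7] [cite: BertoliniDarmon2005, §1.2 (18)–(21)] -/
theorem coeff_thetaAc_eq_sum (hnc : T.IsNormCompatible p φ α) (n : ℕ)
    [Fintype (ClassGroup (quadOrder K (p ^ (n + 1 + 1))))] [Fintype (ClassGroup (quadOrder K (p ^ (n + 1))))]
    [DecidableEq (AcLayerGroup K p (n + 1))] (q : AcLayerGroup K p (n + 1)) :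
    (T.thetaAc p φ α n).coeff q =
      ∑ τ ∈ Finset.univ.filter (fun τ => acProj K p (n + 1) (picRes K (pow_dvd_pow p (n + 1).le_succ) τ) = q),
        (T.theta p φ α (n + 1)).coeff τ := by
  classical
  have h := (mem_completedGroupRing_iff (K := K) (p := p)).mp hnc n
  rw [GrossPointTower.thetaAc, coeff_mapDomainRingHom_eq_sum, ← h]
  simp_rw [coeff_groupRingProj]
  have h1 : ∑ τ ∈ Finset.univ.filter (fun τ => acProj K p (n + 1) (picRes K (pow_dvd_pow p (n + 1).le_succ) τ) = q),
        (T.theta p φ α (n + 1)).coeff τ =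
      ∑ τ ∈ Finset.univ.filter (fun τ => picRes K (pow_dvd_pow p (n + 1).le_succ) τ ∈
        Finset.univ.filter (fun σ => acProj K p (n + 1) σ = q)), (T.theta p φ α (n + 1)).coeff τ := by
    refine Finset.sum_congr ?_ fun _ _ => rfl
    ext τ
    simp
  rw [h1]
  exact Finset.sum_fiberwise_eq_sum_filter _ _ _ _

/-! ### §3 Divisibility descends, a unit coefficient ascends; `HasMuZeroAc` is one witness -/

/-- **`d ∣ θ^{ac}_{n+1} ⇒ d ∣ θ^{ac}_n`** (all coefficients): by §2 the coefficients of `θ^{ac}_n` are sums of coefficients of `θ_{n+1}`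
over unions of `Δ`-cosets of `G̃_{n+2}` (the restriction maps `Δ` into `Δ`), i.e. sums of coefficients of `θ^{ac}_{n+1}`.
[cite: BertoliniDarmon1996, Prop. 2.7] -/
theorem dvd_coeff_thetaAc_of_succ (hnc : T.IsNormCompatible p φ α) (n : ℕ) (d : ℤ_[p])
    (h : ∀ q, d ∣ (T.thetaAc p φ α (n + 1)).coeff q) : ∀ q, d ∣ (T.thetaAc p φ α n).coeff q := by
  classical
  haveI := @Fintype.ofFinite (ClassGroup (quadOrder K (p ^ (n + 1 + 1)))) (finite_classGroup (K := K) _)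
  haveI := @Fintype.ofFinite (ClassGroup (quadOrder K (p ^ (n + 1)))) (finite_classGroup (K := K) _)
  haveI : Fintype (AcLayerGroup K p (n + 1 + 1)) :=
    @Fintype.ofFinite _ (Finite.of_surjective _ (QuotientGroup.mk'_surjective (torsionImage K p (n + 1 + 1))))
  intro q
  rw [coeff_thetaAc_eq_sum p φ α T hnc n q]
  -- the predicate `[τ̄] = q` factors through `G̃_{n+2} → G̃_{n+2}/Δ`
  set πac := QuotientGroup.map (torsionImage K p (n + 1 + 1)) (torsionImage K p (n + 1))
    (picRes K (pow_dvd_pow p (n + 1).le_succ)) (torsionImage_le_comap_picRes p n) with hπac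
  have hmap : ∀ τ : ClassGroup (quadOrder K (p ^ (n + 1 + 1))),
      acProj K p (n + 1) (picRes K (pow_dvd_pow p (n + 1).le_succ) τ) = πac (acProj K p (n + 1 + 1) τ) := fun τ => by
    rw [hπac, QuotientGroup.mk'_apply, QuotientGroup.mk'_apply, QuotientGroup.map_mk]
  have e : ∑ τ ∈ Finset.univ.filter (fun τ => acProj K p (n + 1) (picRes K (pow_dvd_pow p (n + 1).le_succ) τ) = q),
        (T.theta p φ α (n + 1)).coeff τ =
      ∑ τ ∈ Finset.univ.filter (fun τ => πac (acProj K p (n + 1 + 1) τ) = q), (T.theta p φ α (n + 1)).coeff τ := by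
    refine Finset.sum_congr ?_ fun _ _ => rfl
    ext τ
    simp only [Finset.mem_filter, Finset.mem_univ, true_and, hmap]
  rw [e]
  exact dvd_sum_filter_comp_coeff p (acProj K p (n + 1 + 1)) (T.theta p φ α (n + 1)) d h (fun q' => πac q' = q)

/-- **A unit coefficient of `θ^{ac}_n` forces one of `θ^{ac}_{n+1}`.** [cite: PollackWeston2011, §2.3] -/
theorem exists_isUnit_coeff_thetaAc_succ (hnc : T.IsNormCompatible p φ α) (n : ℕ)
    (h : ∃ q, IsUnit ((T.thetaAc p φ α n).coeff q)) : ∃ q, IsUnit ((T.thetaAc p φ α (n + 1)).coeff q) := by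
  by_contra hcon
  push Not at hcon
  obtain ⟨q, hq⟩ := h
  have hall : ∀ q', (p : ℤ_[p]) ∣ (T.thetaAc p φ α (n + 1)).coeff q' := fun q' => by
    have := hcon q'
    rwa [isUnit_iff_not_dvd, not_not] at this
  exact (isUnit_iff_not_dvd p _).mp hq (dvd_coeff_thetaAc_of_succ p φ α T hnc n _ hall q)

/-- A unit coefficient at layer `n` gives one at every layer `n + k`. [cite: PollackWeston2011, §2.3] -/
theorem exists_isUnit_coeff_thetaAc_add (hnc : T.IsNormCompatible p φ α) (n : ℕ)
    (h : ∃ q, IsUnit ((T.thetaAc p φ α n).coeff q)) (k : ℕ) : ∃ q, IsUnit ((T.thetaAc p φ α (n + k)).coeff q) := by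
  induction k with
  | zero => simpa using h
  | succ k ih => exact exists_isUnit_coeff_thetaAc_succ p φ α T hnc (n + k) ih

/-- **`HasMuZeroAc` ⟺ ONE unit coefficient at ONE layer** (for a norm-compatible tower): Vatsal's / Pollack–Weston's "`μ(θ^{ac}_n) = 0`
for all large `n`" (the finite-level form `GrossPointTower.HasMuZeroAc` of `μ(L_p(f, K)) = 0`, named fact `vatsal_hasMuZeroAc`) holds for a
given tower as soon as some `θ^{ac}_n` has a unit coefficient — a finite, per-tower certificate shape (the class-wide theorem is Vatsal's).
[cite: PollackWeston2011, §2.3 Thm. 2.3 (1)] [cite: BertoliniDarmon1996, Prop. 2.7] -/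
theorem hasMuZeroAc_iff_exists (hnc : T.IsNormCompatible p φ α) :
    T.HasMuZeroAc p φ α ↔ ∃ n q, IsUnit ((T.thetaAc p φ α n).coeff q) := by
  constructor
  · rintro ⟨n₀, h⟩
    exact ⟨n₀, h n₀ le_rfl⟩
  · rintro ⟨n, hn⟩
    refine ⟨n, fun m hm => ?_⟩
    obtain ⟨k, rfl⟩ := Nat.exists_eq_add_of_le hm
    exact exists_isUnit_coeff_thetaAc_add p φ α T hnc n hn k

/-- The same in the hypothesis currency of the tree's discharge of BD96 Prop. 2.7 (`GrossPointTowerNormCompat.isNormCompatible`): `K`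
imaginary quadratic, `p ∤ N⁺N⁻`, `T(p)φ = aφ`, `α` a root of `x² − ax + p` in `ℤ_pˣ` (the ordinary unit root).
[cite: PollackWeston2011, §2.3 Thm. 2.3 (1)] [cite: BertoliniDarmon1996, Prop. 2.7] -/
theorem hasMuZeroAc_iff_exists_of_ordinary [Fintype (Brandt.ClassSet S.O)] (hK : IsImaginaryQuadratic K)
    (hpN : ¬ p ∣ Nplus * Nminus) (a : ℤ) (hφ : Brandt.matrix S.O p *ᵥ φ = a • φ)
    (hα : (α : ℤ_[p]) ^ 2 - a * α + p = 0) :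
    T.HasMuZeroAc p φ α ↔ ∃ n q, IsUnit ((T.thetaAc p φ α n).coeff q) :=
  hasMuZeroAc_iff_exists p φ α T (GrossPointTowerNormCompat.isNormCompatible hK hpN φ a hφ α hα T)

end Summit.BirchSwinnertonDyer.BirchSwinnertonDyer.Theorems.AcLayerTheta

end
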